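/-
Origin: expansion seat `planner-pub-hodgecm-mc-axioms-1-g14-0`, handover #W54 2026-08-20T15:53:55Z md5 a6929a4a986b (PKG eb59ff408e49 → a6929a4a986b; 97 l.; MECHANICAL (iib-R) rewrite v3.1 of the PKG file as it stands (22 token edits; rules R1x1+RX[h₂]x21)) (`HOME/mc/pub-hodgecm-mc-axioms-1-g14/revendor/kit-r55/stage55/HodgeCM/Model/OccInstance.lean`, md5 a6929a4a986b, 97 lines);
landed by the gen-22 packager (p-g22) in gate run 55 REPLACES the earlier landed copy of `HodgeCM/Model/OccInstance.lean` (seat copy carried the packager Origin header of an earlier run (stripped)).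
-/
/-
Unit pub-hodgecm-mc-binder-2-g3 (BINDER PROVER, rows A12/A34; vacancy (v20) `occ` PRODUCER, claim 2026-08-18T23:39:43Z).
NEW additive leaf `HodgeCM/Model/OccInstance.lean` (imports `E2Instance` + `PerL34.ArchCHyperbolicSide`; nothing imports it).
No proof holes; every undischarged input is an explicit binder.  Expected `#print axioms`: {propext, Classical.choice, Quot.sound}.
-/
import Summits.HodgeConjecture.HodgeCM.Model.E2Instance
import Summits.HodgeConjecture.HodgeCM.PerL34.ArchCHyperbolicSide

/-!
# E binder `occ` (C7 = PerL Lemma 4.1(c), N29) PRODUCED from the A12/A34 hyperbolic cores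

`Model.occOf`: for the E-instance theta model `thetaModelOf hHD hI h₁ h₃ h emb cover wm Theta d12 d34` the C7 binder

  `occ : ∀ V c, GoodCtx ι₁ c → [K:ℚ] = 6 → (∀ Φ i, (∃ v ∈ (core V c).hatσ i, TΦ Φ v ≠ 0) → (t12 V c).wOccurs i) ∧ (… t34 …)`

of `Model.perL_picardCM_r{2,3,4}` is a THEOREM given, per good sextic context, ONE `HypSmoothCore12` and ONE
`HypSmoothCore34` (PKG `HodgeCM/PerL34/ArchCHyperbolicSide.lean`: kind map of the infinite places, printed scalings
`λ_b ≠ 0`, and the six 𝒯-free fields `FinIdx, ins, dense, omg_ins, e, smooth` = the A12/A34 rows of BINDER-TRIAGE) over the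
end-state core, and a linear structure `lin` on each Weil theta model `wm V c` (`WeilThetaModel.LinearStr`).  The proof is
`HypSmoothCore12/34.H_occ` (which internally supplies linearity of `Φ ↦ 𝒯_Φ` from `lin`, operator-norm continuity
`continuous_TΦc`, N21 `invariance`, and the occurrence `t12_/t34_wOccurs_of_printedEigenvector`), threaded through the
sextic guard.  So the next E revision may REPLACE the opaque binder `occ` by the structured binders `(lin, hyp12, hyp34)`
— exactly as r4 replaced `lines` by `classPacks`; the genuine discharge of `hyp12/hyp34` is the A12/A34 census over the
CONSTRUCTED `wm` (vacancy (v19)), where the archimedean compact clauses of `omg_ins` are already tree kernel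
(`Literature/Analysis/SegalBargmann/SchwartzCompactWeilRep.lean` etc.).
-/

noncomputable section

open scoped TensorProduct InnerProductSpace

namespace HodgeCM

namespace Model

open HodgeCM.Universe (AdelicThetaCore AdelicThetaCore₀ SideData ThetaModel ModelAxiomsPerL)
open Literature.AlgebraicGeometry.HodgeTheory
open Literature.NumberTheory.Automorphic.PicardCM

variable (hHD : exists_isReal_hodgeModel) (hI : hodgePQ_independent_of_hodgeModel)
  (h₁ : BallQuotientUniformised)  (h₃ : CMAbelianVarietyRealised)

/-- **The C7 binder `occ` of the E instance, PRODUCED from hyperbolic cores** (PerL Lemma 4.1(c) / N29 on the end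
state `thetaModelOf …`, both torus sides, at every good sextic context). -/
theorem occOf (h : Bool)
    (emb : ∀ {L : CMField} {ι₁ : L →+* ℂ} {V : HermSpace3 L ι₁} (Γ : Level V),
      (picardCMUniverse hHD hI h₁ h₃).CohC ((picardCMUniverse hHD hI h₁ h₃).pms L ι₁ V Γ) 2 →ₗ[ℂ]
        (V.latticeModel printFact_unitaryCompact_holds).toQuotientModel.H)
    (cover : ∀ {L : CMField} {ι₁ : L →+* ℂ} {V : HermSpace3 L ι₁} (Γ Γ' : Level V),
      Γ'.Γ ≤ Γ.Γ → (picardCMUniverse hHD hI h₁ h₃).Mor ((picardCMUniverse hHD hI h₁ h₃).pms L ι₁ V Γ')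
        ((picardCMUniverse hHD hI h₁ h₃).pms L ι₁ V Γ))
    (wm : ∀ {L : CMField} {ι₁ : L →+* ℂ} (V : HermSpace3 L ι₁) (c : SeesawCtx L),
      WeilThetaModel (V.latticeModel printFact_unitaryCompact_holds).toQuotientModel.G
        (V.latticeModel printFact_unitaryCompact_holds).toQuotientModel.Γ
        (c.D.latticeModelW printFact_unitaryCompact_holds).toQuotientModel.G
        (c.D.latticeModelW printFact_unitaryCompact_holds).toQuotientModel.Γ)
    (Theta : ∀ {L : CMField} {ι₁ : L →+* ℂ} (V : HermSpace3 L ι₁), SeesawCtx L → Fin 4 → ∀ Γ : Level V,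
      Set ((picardCMUniverse hHD hI h₁ h₃).CohC ((picardCMUniverse hHD hI h₁ h₃).pms L ι₁ V Γ) 1))
    (d12 d34 : ∀ {L : CMField}, SeesawCtx L → SideData L)
    (lin : ∀ {L : CMField} {ι₁ : L →+* ℂ} (V : HermSpace3 L ι₁) (c : SeesawCtx L), (wm V c).LinearStr)
    (hyp12 : ∀ {L : CMField} {ι₁ : L →+* ℂ} (V : HermSpace3 L ι₁) (c : SeesawCtx L),
      (thetaModelOf hHD hI h₁ h₃ h emb cover wm Theta d12 d34).GoodCtx ι₁ c → Module.finrank ℚ c.K = 6 →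
      Nonempty (((coreOf _ emb cover wm Theta).toCore h).HypSmoothCore12
        (((coreOf _ emb cover wm Theta).toCore h).side12 d12) (((coreOf _ emb cover wm Theta).toCore h).side34 d34)
        ((((coreOf _ emb cover wm Theta).toCore h).analyticKM (((coreOf _ emb cover wm Theta).toCore h).side12 d12)
          (((coreOf _ emb cover wm Theta).toCore h).side34 d34)).toAnalytic) V c (ℓ := lin V c)))
    (hyp34 : ∀ {L : CMField} {ι₁ : L →+* ℂ} (V : HermSpace3 L ι₁) (c : SeesawCtx L),
      (thetaModelOf hHD hI h₁ h₃ h emb cover wm Theta d12 d34).GoodCtx ι₁ c → Module.finrank ℚ c.K = 6 →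
      Nonempty (((coreOf _ emb cover wm Theta).toCore h).HypSmoothCore34
        (((coreOf _ emb cover wm Theta).toCore h).side12 d12) (((coreOf _ emb cover wm Theta).toCore h).side34 d34)
        ((((coreOf _ emb cover wm Theta).toCore h).analyticKM (((coreOf _ emb cover wm Theta).toCore h).side12 d12)
          (((coreOf _ emb cover wm Theta).toCore h).side34 d34)).toAnalytic) V c (ℓ := lin V c))) :
    ∀ {L : CMField} {ι₁ : L →+* ℂ} (V : HermSpace3 L ι₁) (c : SeesawCtx L),
      (thetaModelOf hHD hI h₁ h₃ h emb cover wm Theta d12 d34).GoodCtx ι₁ c → Module.finrank ℚ c.K = 6 →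
      (∀ (Φ : (thetaModelOf hHD hI h₁ h₃ h emb cover wm Theta d12 d34).SK V c)
          (i : (thetaModelOf hHD hI h₁ h₃ h emb cover wm Theta d12 d34).SigIdx V c),
          (∃ v ∈ ((thetaModelOf hHD hI h₁ h₃ h emb cover wm Theta d12 d34).core V c).hatσ i,
              ((thetaModelOf hHD hI h₁ h₃ h emb cover wm Theta d12 d34).core V c).TΦ Φ v ≠ 0) →
          ((thetaModelOf hHD hI h₁ h₃ h emb cover wm Theta d12 d34).t12 V c).wOccurs i) ∧
        (∀ (Φ : (thetaModelOf hHD hI h₁ h₃ h emb cover wm Theta d12 d34).SK V c)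
          (i : (thetaModelOf hHD hI h₁ h₃ h emb cover wm Theta d12 d34).SigIdx V c),
          (∃ v ∈ ((thetaModelOf hHD hI h₁ h₃ h emb cover wm Theta d12 d34).core V c).hatσ i,
              ((thetaModelOf hHD hI h₁ h₃ h emb cover wm Theta d12 d34).core V c).TΦ Φ v ≠ 0) →
          ((thetaModelOf hHD hI h₁ h₃ h emb cover wm Theta d12 d34).t34 V c).wOccurs i) :=
  fun V c hc hK =>
    ⟨fun Φ i hΦ => (hyp12 V c hc hK).elim fun A => A.H_occ (ℓ := lin V c) Φ i hΦ,
      fun Φ i hΦ => (hyp34 V c hc hK).elim fun A => A.H_occ (ℓ := lin V c) Φ i hΦ⟩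

end Model

end HodgeCM

end
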